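import Mathlib
import Literature.MathematicalPhysics.QuantumFieldTheory.Balaban1983to89.B6Prop22BoxLaplacian

/-!
# `Balaban1983to89.B6OneScaleBoxFamily` — T. Bałaban, *Propagators and renormalization transformations for lattice gauge
theories. II*, Commun. Math. Phys. **96** (1984) 223–250 [Balaban1984PropagatorsII]: the ONE-SCALE BOX FAMILY as a
`B6.Geometry` with HONEST readings of its abstract fields (test functions, supports, sup norm, Hölder seminorm, cut-offs),
the unit-lattice calculus (forward differences ∇_μ, their adjoints, the Hölder seminorm) and the (2.67)-family
`B6.GpFamily` of `G′ = (−Δ_𝔅 + a)⁻¹` — the objects on which the companion `…B6Prop22BoxFamily` proves the printed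
Proposition 2.2 (`B6.Prop22Printed`) with no analytic hypothesis

statement-level skeleton of published theorems with citation tags; proofs where landed; nothing here is a claim about the Yang–Mills mass gap.
PDF held: `paper:balaban1984-cmp96-propagators-rt-ii` (journal page = PDF page + 222); pp. 224–235 [PDF 2–13] read this
session (`lit read paper:balaban1984-cmp96-propagators-rt-ii --pages 7-16`, ×2 renders `…-p012-x2.png`, `…-p013-x2.png`).

CITATION HEADER (cell `lit-balaban`, Phase-2 proof seat `p01` (gen 3) = unit `lit-balaban-p01`, HOME
`run/shared/lean/pub/lit-balaban/`, `PHASE2-TARGETS.md` §G, G.5-34(d)); SKELETON row **`B6.Prop2.2`** (the verbatim typing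
`B6.Prop22Printed` of `…B6`, to be inhabited by a non-degenerate family); imports this seat's `…B6Prop22BoxLaplacian`
(p248905; `prop22_entry1_neumannLaplacian`) and through it `…B6Ineq243BoxProof` (p248732), `…B6CoverBox` (`bdist`, `crd`,
`Kbox`; cell pub-balaban b06-g17) and `…B6` (`B6.Geometry`, `B6.GpFamily`, `B6.pref4`, `B6.Prop22Printed`; b2b).
WHAT THE PAPER PRINTS.  p. 234 [PDF 12], Proposition 2.2 (2.67): *"|(G′λ)(x)|, |(∇G′λ)(x)|, |(G′∇*λ)(x)|, ‖ζ∇G′λ‖_α,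
‖ζG′∇*λ‖_α, |(ΔG′λ)(x)| ≤ O(1)[(L^jη)², L^jη, L^jη, (L^jη)^{1−α}(‖ζ‖_α + |ζ|), (L^jη)^{1−α}(‖ζ‖_α + |ζ|), 1]
e^{−½δ₀d(y,y′)}|λ|, x ∈ B^j(y) or supp ζ ⊂ B^j(y), y ∈ Λ_j, supp λ ⊂ B^{j′}(y′), y′ ∈ Λ_{j′}"*; p. 235 [PDF 13]: *"If we
have one scale, i.e. Λ_k = T₁^{(k)}, then the operator is a unit lattice operator"*; (2.13) p. 225: *"Δ′_a = Δ + Q′*aQ′ …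
(Q′₀λ)(x) = λ(x) on Λ₀"*; p. 229: *"Λ_j scaled to unit lattice"*.
WHAT IS DEFINED / PROVED HERE (definitions with bodies, 0 sorry, 0 named facts):
§1 on the box {0,…,S−1}^d (`Fin d → Fin S`, ℓ¹ distance `B6CoverBox.bdist`): `shiftUp μ x` (x + e_μ, clamped at the upper
  face: Neumann convention), the forward difference `fwdDiff μ` as a matrix with `fwdDiff_mulVec` ((∇_μf)(x) = f(x + e_μ) −
  f(x)) and `mul_fwdDiff_transpose_apply` ((G′∇_μ*)(y,y′) = G′(y, y′+e_μ) − G′(y,y′)), the Hölder seminorm `holderSemi α f =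
  sup_{x≠x′}|f(x) − f(x′)|/|x−x′|₁^α` with `holderSemi_nonneg`, `holderSemi_le_of_supp` (a function supported at one site y has
  ‖f‖_α ≤ |f(y)|: distinct sites are at distance ≥ 1, `one_le_bdist_of_ne`), `bdist_shiftUp_le`.
§2 `negLap d n m` = −Δ_𝔅 (Mathlib `SimpleGraph.lapMatrix` of the nearest-neighbour graph of the box — the Δ = ∂*∂ ≥ 0 of
  (2.13)), `green d n m a` = G′ = (−Δ_𝔅 + a)⁻¹, **`oneScaleGeo d n m`** = the `B6.Geometry` of the one-scale box with the
  readings Site = blocks = {0,…,nM}^d, scale 0, L = η = 1 (L^jη = 1, `oneScaleGeo_len`), M = the cube size, (2.1)–(2.2)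
  trivially true on one level, Loc = functions λ, suppIn λ y′ = (supp λ ⊂ {y′}), supNorm = sup norm, holder = `holderSemi`,
  Cut = functions ζ, cutIn ζ y = (supp ζ ⊂ {y}), cutH α ζ = ‖ζ‖_α + |ζ|; **`boxGp d n m a`** = the (2.67)-family of G′
  read at the block {y}: e₀ = |(G′λ)(y)|, e₁ = Σ_μ|(∇_μG′λ)(y)|, e₂ = Σ_μ|(G′∇_μ*λ)(y)|, e₃ = |(ΔG′λ)(y)|, h1 λ α ζ =
  Σ_μ(‖ζ∇_μG′λ‖_α + ‖ζG′∇_μ*λ‖_α) (sums over μ DOMINATE the printed componentwise quantities); `pref4_one` (the prefactor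
  table is ≡ 1 at L^jη = 1); `negLap_mul_green` (ΔG′ = 1 − aG′, a > 0, by coercivity of −Δ_𝔅 + a,
  `SimpleGraph.posSemidef_lapMatrix` + `QGQInverse.isUnit_of_coercive`).
HONEST SCOPE.  Objects and dictionary only (no estimate is claimed here); one scale, blocks = sites, box (not torus),
Neumann clamping of ∇_μ at the upper faces; Δ′_a = −Δ_𝔅 + a is the (2.13) operator only on one scale with Q′₀ = I.
-/

namespace Literature.MathematicalPhysics.QuantumFieldTheory.Balaban1983to89.B6OneScaleBoxFamily

open Finset Matrix
open B6CoverBox (bdist Kbox bdist_self bdist_comm bdist_triangle bdist_nonneg crd)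

noncomputable section

variable {d S : ℕ}
/-! ## §1. Lattice calculus on the box: forward differences, their adjoints, the Hölder seminorm -/

/-- The neighbour `x + e_μ` of a box site in the direction μ (clamped at the upper face of the box: there `x + e_μ := x`,
so that the forward difference vanishes — Neumann convention). [cite: Balaban1984PropagatorsII, (2.67) p.234] -/
def shiftUp (μ : Fin d) (x : Fin d → Fin S) : Fin d → Fin S :=
  Function.update x μ (if h : (x μ : ℕ) + 1 < S then ⟨(x μ : ℕ) + 1, h⟩ else x μ)

/-- The forward difference `(∇_μf)(x) = f(x + e_μ) − f(x)` on the unit-lattice box, as a matrix (row x: +1 at x + e_μ,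
−1 at x). [cite: Balaban1984PropagatorsII, (2.67) p.234] -/
def fwdDiff (μ : Fin d) : Matrix (Fin d → Fin S) (Fin d → Fin S) ℝ :=
  fun x z => (if z = shiftUp μ x then 1 else 0) - (if z = x then 1 else 0)

/-- The Hölder seminorm `‖f‖_α = sup_{x ≠ x′} |f(x) − f(x′)|/|x − x′|₁^α` of a function on the box (the pair x = x′
contributes 0). [cite: Balaban1984PropagatorsII, (2.67) p.234] -/
def holderSemi (α : ℝ) (f : (Fin d → Fin S) → ℝ) : ℝ :=
  ⨆ p : (Fin d → Fin S) × (Fin d → Fin S), |f p.1 - f p.2| / bdist p.1 p.2 ^ α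

/-- `x + e_μ` is at ℓ¹ distance ≤ 1 from x (the one-level distance (2.46) = |x − y|₁). [cite: Balaban1984PropagatorsII, (2.46) p.231] -/
theorem bdist_shiftUp_le (μ : Fin d) (x : Fin d → Fin S) : bdist x (shiftUp μ x) ≤ 1 := by
  unfold bdist
  have hterm : ∀ ν, |crd x ν - crd (shiftUp μ x) ν| ≤ if ν = μ then 1 else 0 := by
    intro ν
    unfold crd shiftUp
    by_cases hν : ν = μ
    · subst hν
      rw [if_pos rfl, Function.update_self]
      split_ifs with h
      · simp
      · simp
    · rw [if_neg hν, Function.update_of_ne hν, sub_self, abs_zero]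
  calc ∑ ν, |crd x ν - crd (shiftUp μ x) ν| ≤ ∑ ν, (if ν = μ then (1 : ℝ) else 0) :=
        Finset.sum_le_sum fun ν _ => hterm ν
    _ = 1 := by simp

/-- `(∇_μf)(x) = f(x + e_μ) − f(x)`. [cite: Balaban1984PropagatorsII, (2.67) p.234] -/
theorem fwdDiff_mulVec (μ : Fin d) (f : (Fin d → Fin S) → ℝ) (x : Fin d → Fin S) :
    (fwdDiff μ *ᵥ f) x = f (shiftUp μ x) - f x := by
  simp only [Matrix.mulVec, dotProduct, fwdDiff, sub_mul, Finset.sum_sub_distrib, ite_mul, one_mul, zero_mul,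
    Finset.sum_ite_eq', Finset.mem_univ, if_true]

/-- The kernel of `G′∇_μ*` (∇_μ* = the transpose of ∇_μ): `(G′∇_μ*)(y, y′) = G′(y, y′ + e_μ) − G′(y, y′)`.
[cite: Balaban1984PropagatorsII, (2.67) p.234] -/
theorem mul_fwdDiff_transpose_apply (μ : Fin d) (G : Matrix (Fin d → Fin S) (Fin d → Fin S) ℝ)
    (y y' : Fin d → Fin S) :
    (G * (fwdDiff μ : Matrix (Fin d → Fin S) (Fin d → Fin S) ℝ)ᵀ) y y' = G y (shiftUp μ y') - G y y' := by
  simp only [Matrix.mul_apply, Matrix.transpose_apply, fwdDiff, mul_sub, Finset.sum_sub_distrib, mul_ite, mul_one,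
    mul_zero, Finset.sum_ite_eq', Finset.mem_univ, if_true]

/-- Distinct box sites are at ℓ¹ distance ≥ 1. [folklore] -/
private theorem one_le_bdist_of_ne {x y : Fin d → Fin S} (h : x ≠ y) : 1 ≤ bdist x y := by
  obtain ⟨μ, hμ⟩ := Function.ne_iff.mp h
  have hμ' : (x μ : ℕ) ≠ (y μ : ℕ) := fun e => hμ (Fin.ext e)
  have h1 : (1 : ℝ) ≤ |crd x μ - crd y μ| := by
    unfold crd
    rcases lt_or_gt_of_ne hμ' with hab | hab
    · have : ((x μ : ℕ) : ℝ) + 1 ≤ ((y μ : ℕ) : ℝ) := by exact_mod_cast hab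
      rw [abs_sub_comm, abs_of_nonneg (by linarith)]
      linarith
    · have : ((y μ : ℕ) : ℝ) + 1 ≤ ((x μ : ℕ) : ℝ) := by exact_mod_cast hab
      rw [abs_of_nonneg (by linarith)]
      linarith
  exact h1.trans (B6CoverBox.abs_crd_sub_le_bdist x y μ)

/-- The Hölder seminorm of (2.67) is ≥ 0. [cite: Balaban1984PropagatorsII, (2.67) p.234] -/
theorem holderSemi_nonneg [NeZero S] (α : ℝ) (f : (Fin d → Fin S) → ℝ) : 0 ≤ holderSemi α f := by
  obtain ⟨x⟩ : Nonempty (Fin d → Fin S) := ⟨fun _ => 0⟩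
  unfold holderSemi
  refine le_trans ?_ (le_ciSup (Set.finite_range _).bddAbove (x, x))
  simp [bdist_self]

/-- A function supported at ONE site y (one block of the one-scale lattice) has `‖f‖_α ≤ |f(y)|` for every α ≥ 0
(distinct sites are at distance ≥ 1, so `|x − x′|₁^α ≥ 1`) — the unit-lattice form of the Hölder entries of (2.67).
[cite: Balaban1984PropagatorsII, (2.67) p.234] -/
theorem holderSemi_le_of_supp [NeZero S] {α : ℝ} (hα : 0 ≤ α) {f : (Fin d → Fin S) → ℝ} {y : Fin d → Fin S}
    (hf : ∀ x, x ≠ y → f x = 0) : holderSemi α f ≤ |f y| := by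
  obtain ⟨x0⟩ : Nonempty (Fin d → Fin S) := ⟨fun _ => 0⟩
  unfold holderSemi
  refine ciSup_le fun p => ?_
  rcases p with ⟨x, x'⟩
  dsimp only
  by_cases hxx : x = x'
  · subst hxx
    simp
  · have hd : (1 : ℝ) ≤ bdist x x' ^ α := Real.one_le_rpow (one_le_bdist_of_ne hxx) hα
    have hnum : |f x - f x'| ≤ |f y| := by
      by_cases hx : x = y
      · subst hx
        rw [hf x' (Ne.symm hxx), sub_zero]
      · rw [hf x hx, zero_sub, abs_neg]
        by_cases hx' : x' = y
        · subst hx'; exact le_rfl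
        · rw [hf x' hx', abs_zero]; exact abs_nonneg _
    calc |f x - f x'| / bdist x x' ^ α ≤ |f x - f x'| / 1 :=
          div_le_div_of_nonneg_left (abs_nonneg _) one_pos hd
      _ ≤ |f y| := by rw [div_one]; exact hnum

/-! ## §2. The one-scale box family: −Δ_𝔅, G′ = (−Δ_𝔅 + a)⁻¹, the geometry with honest readings, the (2.67)-family -/

section Family

open Classical in
/-- −Δ_𝔅: the graph Laplacian of the nearest-neighbour graph of the box 𝔅 = {0,…,nM}^d (Neumann), Mathlib's
`SimpleGraph.lapMatrix` — the Δ = ∂*∂ ≥ 0 of (2.13) on one scale. [cite: Balaban1984PropagatorsII, (2.13) p.225] -/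
def negLap (d n m : ℕ) : Matrix (Fin d → Fin (n * m + 1)) (Fin d → Fin (n * m + 1)) ℝ :=
  (SimpleGraph.fromRel fun x y : Fin d → Fin (n * m + 1) => bdist x y = 1).lapMatrix ℝ

/-- G′ = Δ′_a⁻¹ = (−Δ_𝔅 + a)⁻¹, the operator of Proposition 2.2 on the one-scale box (Q′₀ = I in (2.13)).
[cite: Balaban1984PropagatorsII, Prop. 2.2 p.234; (2.13) p.225] -/
def green (d n m : ℕ) (a : ℝ) : Matrix (Fin d → Fin (n * m + 1)) (Fin d → Fin (n * m + 1)) ℝ :=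
  (a • (1 : Matrix (Fin d → Fin (n * m + 1)) (Fin d → Fin (n * m + 1)) ℝ) + negLap d n m)⁻¹

/-- **The one-scale box geometry with HONEST readings of the abstract fields of `B6.Geometry`**: sites = blocks =
{0,…,nM}^d (one scale, *"Λ_j scaled to unit lattice"*, j = 0, L^jη = 1), d = the ℓ¹ distance (2.46) on one level, M = the
block-cube size, (2.1)–(2.2) trivially true on one level; `Loc` = functions λ on the box, `suppIn λ y′` = supp λ ⊂ B(y′)
= {y′}, `supNorm` = the sup norm |λ|, `holder` = the Hölder seminorm, `Cut` = cut-off functions ζ, `cutIn ζ y` = supp ζ ⊂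
B(y), `cutH α ζ` = ‖ζ‖_α + |ζ|. [cite: Balaban1984PropagatorsII, (2.1)–(2.2) p.224, (2.46) p.231, (2.67) p.234] -/
@[reducible] def oneScaleGeo (d n m : ℕ) : B6.Geometry where
  Site := Fin d → Fin (n * m + 1)
  fin := inferInstance
  scale := fun _ => 0
  dist := bdist
  k := 0
  eta := 1
  L := 1
  R := 1
  M := m
  Hyp21_22 := True
  Loc := (Fin d → Fin (n * m + 1)) → ℝ
  suppIn := fun lam y' => ∀ x, x ≠ y' → lam x = 0
  supNorm := fun lam => ‖lam‖
  l2Norm := fun lam => Real.sqrt (∑ x, lam x ^ 2)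
  holder := fun α lam => holderSemi α lam
  Cut := (Fin d → Fin (n * m + 1)) → ℝ
  cutIn := fun ζ y => ∀ x, x ≠ y → ζ x = 0
  cutH := fun α ζ => holderSemi α ζ + ‖ζ‖
  cutSup := fun ζ => ‖ζ‖

/-- **The (2.67)-family of G′ = (−Δ_𝔅 + a)⁻¹ on the one-scale box**, read honestly at a block B(y) = {y}: entry 0 =
`|(G′λ)(y)|`; entry 1 = `Σ_μ |(∇_μG′λ)(y)|` (dominates every `|(∇_μG′λ)(y)|`); entry 2 = `Σ_μ |(G′∇_μ*λ)(y)|`; entry 3 =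
`|(ΔG′λ)(y)|` (Δ = −Δ_𝔅 = ∂*∂); `h1 λ α ζ` = `Σ_μ (‖ζ∇_μG′λ‖_α + ‖ζG′∇_μ*λ‖_α)` (dominates the printed
max{‖ζ∇G′λ‖_α, ‖ζG′∇*λ‖_α} componentwise). [cite: Balaban1984PropagatorsII, Prop. 2.2 (2.67) p.234] -/
def boxGp (d n m : ℕ) (a : ℝ) : B6.GpFamily (oneScaleGeo d n m) where
  e := fun i lam y =>
    if i = 0 then |(green d n m a *ᵥ lam) y|
    else if i = 1 then ∑ μ : Fin d, |(fwdDiff μ *ᵥ (green d n m a *ᵥ lam)) y|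
    else if i = 2 then
      ∑ μ : Fin d, |(green d n m a *ᵥ ((fwdDiff μ : Matrix _ _ ℝ)ᵀ *ᵥ lam)) y|
    else |(negLap d n m *ᵥ (green d n m a *ᵥ lam)) y|
  h1 := fun lam α ζ =>
    ∑ μ : Fin d, (holderSemi α (fun x => ζ x * (fwdDiff μ *ᵥ (green d n m a *ᵥ lam)) x) +
      holderSemi α (fun x => ζ x * (green d n m a *ᵥ ((fwdDiff μ : Matrix _ _ ℝ)ᵀ *ᵥ lam)) x))

/-- L^jη = 1 on the one-scale box (*"scaled to unit lattice"*). [cite: Balaban1984PropagatorsII, p.229] -/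
@[simp] theorem oneScaleGeo_len (d n m : ℕ) (y : (oneScaleGeo d n m).Site) : (oneScaleGeo d n m).len y = 1 := by
  simp [B6.Geometry.len]

/-- The table of prefactors [(L^jη)², L^jη, L^jη, 1] is ≡ 1 at L^jη = 1. [cite: Balaban1984PropagatorsII, (2.67) p.234] -/
theorem pref4_one (i : Fin 4) : B6.pref4 1 i = 1 := by
  fin_cases i <;> simp [B6.pref4]

/-- `ΔG′ = 1 − aG′` for G′ = (Δ + a)⁻¹, a > 0 (Δ = −Δ_𝔅 ≥ 0, so Δ + a is coercive, hence invertible).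
[cite: Balaban1984PropagatorsII, (2.13) p.225] -/
theorem negLap_mul_green (d n m : ℕ) {a : ℝ} (ha : 0 < a) :
    negLap d n m * green d n m a = 1 - a • green d n m a := by
  classical
  set Dm := a • (1 : Matrix (Fin d → Fin (n * m + 1)) (Fin d → Fin (n * m + 1)) ℝ) + negLap d n m with hDm
  have hcoer : QGQInverse.Coercive Dm a := by
    intro v
    have hL : 0 ≤ v ⬝ᵥ (negLap d n m *ᵥ v) := by
      have := ((SimpleGraph.fromRel fun x y : Fin d → Fin (n * m + 1) => bdist x y = 1).posSemidef_lapMatrix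
        ℝ).dotProduct_mulVec_nonneg v
      simpa [negLap] using this
    rw [hDm, Matrix.add_mulVec, Matrix.smul_mulVec, Matrix.one_mulVec, dotProduct_add, dotProduct_smul,
      smul_eq_mul]
    linarith
  have hunit : IsUnit Dm.det :=
    (Matrix.isUnit_iff_isUnit_det Dm).mp (QGQInverse.isUnit_of_coercive ha hcoer)
  have h1 : Dm * green d n m a = 1 := by
    rw [green, ← hDm]
    exact Matrix.mul_nonsing_inv Dm hunit
  have h2 : Dm * green d n m a = a • green d n m a + negLap d n m * green d n m a := by
    rw [hDm, Matrix.add_mul, Matrix.smul_mul, Matrix.one_mul]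
  rw [eq_sub_iff_add_eq, add_comm (negLap d n m * green d n m a), ← h2, h1]

end Family

end

end Literature.MathematicalPhysics.QuantumFieldTheory.Balaban1983to89.B6OneScaleBoxFamily
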